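import Summits.Ventures.PercRepro.RankLevelSetBiIndepParallel

/-! # RankLevelSetBiIndepMonoParallel — MONO IS CLOSED UNDER PARALLEL EXTENSION: FOR A PARALLEL PAIR `{y, z}`,
MONO OF `M ／ {y} ＼ {z}` GIVES MONO OF `M` (night-1 g31; dossier §43.5)

For a parallel pair `{y, z}` of `M` and `N = M ／ {y} ＼ {z}` (g25's reduction), every bi-independent set of `M` contains
exactly one of `y, z`, and `S ↦ S ∖ {y}` (resp. `S ∖ {z}`) is a bijection onto the bi-independent sets of `N` one level
down: `D_{j+1}(M) = 2·D_j(N)` (**`biIndepCount_succ_of_parallel`**), and `D_0(M) = 0`. Hence the monotone form of the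
profile of `N` — `(#E − 2 − i)·D_i(N) ≤ (i + 1)·D_{i+1}(N)` — gives that of `M`:
`(#E − (i + 1))·D_{i+1}(M) ≤ (i + 2)·D_{i+2}(M)` follows from the step of `N` at `i` together with `D_i(N) ≤ D_{i+1}(N)`
(**`biIndepMono_of_parallel`**). With `biIndepMono_disjointSum` and `biIndepMono_truncateTo`
(`RankLevelSetBiIndepMonoSum`), Mono — C-025's residue — is closed under direct sums, truncations and parallel
extensions. Every declaration has a docstring; imports: the cell's own modules and Mathlib only. Axioms: standard. -/

namespace PercRepro

open Set Matroid

variable {α : Type} (M : Matroid α) [M.Finite]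

/-- **The profile of `M` is twice the profile of `N = M ／ {y} ＼ {z}` one level down**: `D_{j+1}(M) = 2·D_j(N)`. -/
lemma biIndepCount_succ_of_parallel {y z : α} (h : ParallelPair M y z) (j : ℕ) :
    biIndepCount M (j + 1) = 2 * biIndepCount ((M.contract {y}).delete {z}) j := by
  have hsplit := ncard_biIndep_split M h (j + 1) (fun _ => True)
  have hl := ncard_biIndep_mem_left_eq M h j (fun _ => True)
  have hr := ncard_biIndep_mem_right_eq M h j (fun _ => True)
  simp only [and_true] at hsplit hl hr
  unfold biIndepCount
  have e1 : {S | S ∈ biIndep M (j + 1)} = biIndep M (j + 1) := by ext S; simp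
  have e2 : {T | T ∈ biIndep ((M.contract {y}).delete {z}) j} = biIndep ((M.contract {y}).delete {z}) j := by
    ext T; simp
  rw [e1] at hsplit
  rw [hsplit, hl, hr, e2]
  ring

/-- **MONO IS CLOSED UNDER PARALLEL EXTENSION**: for a parallel pair `{y, z}`,
`BiIndepMono (M ／ {y} ＼ {z}) → BiIndepMono M`. -/
theorem biIndepMono_of_parallel {y z : α} (h : ParallelPair M y z)
    (hN : BiIndepMono ((M.contract {y}).delete {z})) : BiIndepMono M := by
  intro j hj
  have hn := ncard_ground_contract_delete M h
  rcases j with _ | i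
  · -- level `0` is empty: the ground set is dependent
    have h0 : biIndepCount M 0 = 0 := by
      unfold biIndepCount
      rw [biIndep_zero_eq_empty M h, Set.ncard_empty]
    rw [h0, Nat.mul_zero]
    exact Nat.zero_le _
  · haveI : ((M.contract {y}).delete {z}).Finite := by infer_instance
    rw [biIndepCount_succ_of_parallel M h i, biIndepCount_succ_of_parallel M h (i + 1)]
    have hstep := hN i (by omega)
    have hle := biIndepCount_le_succ_of_biIndepMono ((M.contract {y}).delete {z}) hN (i := i) (by omega)
    rw [hn] at hstep
    have e : M.E.ncard - (i + 1) = M.E.ncard - 2 - i + 1 := by omega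
    rw [e]
    calc (M.E.ncard - 2 - i + 1) * (2 * biIndepCount ((M.contract {y}).delete {z}) i)
        = 2 * ((M.E.ncard - 2 - i) * biIndepCount ((M.contract {y}).delete {z}) i)
          + 2 * biIndepCount ((M.contract {y}).delete {z}) i := by ring
      _ ≤ 2 * ((i + 1) * biIndepCount ((M.contract {y}).delete {z}) (i + 1))
          + 2 * biIndepCount ((M.contract {y}).delete {z}) (i + 1) :=
          Nat.add_le_add (Nat.mul_le_mul_left _ hstep) (Nat.mul_le_mul_left _ hle)
      _ = (i + 1 + 1) * (2 * biIndepCount ((M.contract {y}).delete {z}) (i + 1)) := by ring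

end PercRepro
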